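import Summits.AtomisticToContinuum.Crystallization.Theorems.ChargedEnergyGapStackingLedger
import Literature.MathematicalPhysics.StatisticalMechanics.HcpHomogeneous
import HarnessLib

/-!
# Charged energy gap — lens-3 g62, part P-U: the hcp reference is FORCE-FREE (site symmetry), for every cell `(a, h)`

Cell `decomp-a2c`, seat lens-3, generation 62, part P-U (after P-T).  ELEMENTARY·PROVED, no analysis (no summability is needed: re-indexing a `tsum` along an
equivalence and pushing a continuous linear equivalence through a `tsum` are unconditional).  Memo g62 §1.7 prices the hcp-CELL chart by the
admissibility of the hcp reference block: `IsSiteStressFree` (P-N two-atom lemma + census box), `HarmStableModRot` (STAB-k) and `IsForceFree` — the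
last is settled here outright: (1) TRANSPORT (`siteForce_eq_map_of_homogeneous`): if `q ∈ P.points ↔ y + B q ∈ P.points` for a linear isometry `B`
(the tree's `hcpPeriodicConfiguration_homogeneous`), the site force at `y` is `B` applied to the site force at the origin; (2) INVARIANCE
(`siteForce_zero_eq_map`): a linear isometry mapping the point set onto itself fixes the force at the origin; (3) the hcp point set is mapped onto itself
by the three mirrors `negX` `(x,y,z) ↦ (−x,y,z)`, `negZ` `(x,y,z) ↦ (x,y,−z)` and `swapUV` (the vertical mirror exchanging the layer generators `u`,
`v` and fixing the offset `w`), whose only common fixed vector is `0` (`eq_zero_of_fixed`).  Hence ★★ `isForceFree_hcp : IsForceFree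
(hcpPeriodicConfiguration ha hh)` for all `a, h ≠ 0`; `isSeparatedRef_hcp` (`s ≤ min a h`, from the tree's `le_dist_of_mem_barlowStacking`) and
`isLabelledRef_hcp` (identity chart) give ★★ `hcp_admissible_symmetric : IsSeparatedRef (3/5) ∧ IsLabelledRef (1/3) 3 ∧ IsForceFree` for every cell
of the Barlow window.
-/

noncomputable section

open scoped Classical

open Literature.MathematicalPhysics.StatisticalMechanics Literature.Geometry.DiscreteGeometry
open Summit.AtomisticToContinuum.Crystallization.Theses.PricedLinkCensus
open Summit.AtomisticToContinuum.Crystallization.Theorems.ChargedEnergyGapNegative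

namespace Summit.AtomisticToContinuum.Crystallization.Theorems.ChargedEnergyGapChartDial

section HcpForceFree

/-- The **SITE FORCE** of the reference `P` at `y` (the vector whose vanishing at every motif site is `IsForceFree P`). -/
def siteForce (P : PeriodicConfiguration 3) (y : E3) : E3 :=
  ∑' z : {z : E3 // z ∈ P.points ∧ z ≠ y}, (ljD1 (dist y z) / dist y (z : E3)) • ((z : E3) - y)

/-- `isForceFree_iff_siteForce` (docstring added by the landing lane; see the module docstring). [formal bookkeeping] -/
theorem isForceFree_iff_siteForce (P : PeriodicConfiguration 3) : IsForceFree P ↔ ∀ y ∈ P.motif, siteForce P y = 0 := Iff.rfl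

/-- Transport equivalence: `q ↦ y + B q` between the punctured point set at `0` and at `y`. -/
def transportEquiv (S : Set E3) (y : E3) (B : E3 ≃ₗᵢ[ℝ] E3) (hB : ∀ q, q ∈ S ↔ y + B q ∈ S) :
    {q : E3 // q ∈ S ∧ q ≠ 0} ≃ {z : E3 // z ∈ S ∧ z ≠ y} where
  toFun q := ⟨y + B q.1, (hB q.1).1 q.2.1, fun h => q.2.2 (by
    have h' : B q.1 = 0 := by
      have := congrArg (fun v => v - y) h
      simpa using this
    exact (LinearIsometryEquiv.map_eq_zero_iff B).1 h')⟩
  invFun z := ⟨B.symm (z.1 - y), by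
    have := (hB (B.symm (z.1 - y))).2
    rw [LinearIsometryEquiv.apply_symm_apply, add_sub_cancel] at this
    exact this z.2.1, fun h => z.2.2 (by
    have h' : z.1 - y = 0 := by
      have := congrArg B h
      rw [LinearIsometryEquiv.apply_symm_apply, LinearIsometryEquiv.map_zero] at this
      exact this
    exact sub_eq_zero.1 h')⟩
  left_inv q := Subtype.ext (by simp)
  right_inv z := Subtype.ext (by simp)

/-- ★ **TRANSPORT**: under a homogeneity isometry `B` at `y` the site force at `y` is `B` of the site force at the origin. -/
theorem siteForce_eq_map_of_homogeneous (P : PeriodicConfiguration 3) {y : E3} (B : E3 ≃ₗᵢ[ℝ] E3)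
    (hB : ∀ q, q ∈ P.points ↔ y + B q ∈ P.points) : siteForce P y = B (siteForce P 0) := by
  unfold siteForce
  rw [← (transportEquiv P.points y B hB).tsum_eq]
  have hterm : ∀ q : {q : E3 // q ∈ P.points ∧ q ≠ 0},
      (ljD1 (dist y ((transportEquiv P.points y B hB q : {z : E3 // z ∈ P.points ∧ z ≠ y}) : E3)) /
          dist y ((transportEquiv P.points y B hB q : {z : E3 // z ∈ P.points ∧ z ≠ y}) : E3)) •
        (((transportEquiv P.points y B hB q : {z : E3 // z ∈ P.points ∧ z ≠ y}) : E3) - y)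
      = B ((ljD1 (dist 0 (q : E3)) / dist 0 (q : E3)) • ((q : E3) - 0)) := by
    intro q
    have hq : ((transportEquiv P.points y B hB q : {z : E3 // z ∈ P.points ∧ z ≠ y}) : E3) = y + B q.1 := rfl
    have hd : dist y (y + B q.1) = dist 0 (q : E3) := by
      rw [dist_eq_norm, dist_eq_norm, zero_sub, norm_neg, sub_add_cancel_left, norm_neg, B.norm_map]
    rw [hq, hd, add_sub_cancel_left, sub_zero, LinearIsometryEquiv.map_smul]
  rw [tsum_congr hterm]
  exact (B.toContinuousLinearEquiv.map_tsum).symm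

/-- ★ **INVARIANCE**: a linear isometry mapping the point set onto itself fixes the site force at the origin. -/
theorem siteForce_zero_eq_map (P : PeriodicConfiguration 3) (A : E3 ≃ₗᵢ[ℝ] E3) (hA : ∀ q, q ∈ P.points ↔ A q ∈ P.points) :
    siteForce P 0 = A (siteForce P 0) :=
  siteForce_eq_map_of_homogeneous P A (fun q => by rw [zero_add]; exact hA q)

/-! ### Three mirrors of `ℝ³` -/

/-- `(x, y, z) ↦ (−x, y, z)`. -/
def negXFun (v : E3) : E3 := !₂[-v 0, v 1, v 2]
/-- `(x, y, z) ↦ (x, y, −z)`. -/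
def negZFun (v : E3) : E3 := !₂[v 0, v 1, -v 2]
/-- The vertical mirror exchanging the triangular generators `u = (a,0,0)` and `v = (a/2, a√3/2, 0)`:
`(x, y, z) ↦ (x/2 + (√3/2) y, (√3/2) x − y/2, z)`. -/
def swapUVFun (v : E3) : E3 := !₂[v 0 / 2 + Real.sqrt 3 / 2 * v 1, Real.sqrt 3 / 2 * v 0 - v 1 / 2, v 2]

/-- `negXFun_apply_zero` (docstring added by the landing lane; see the module docstring). [formal bookkeeping] -/
@[simp] theorem negXFun_apply_zero (v : E3) : negXFun v 0 = -v 0 := by simp [negXFun]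
/-- `negXFun_apply_one` (docstring added by the landing lane; see the module docstring). [formal bookkeeping] -/
@[simp] theorem negXFun_apply_one (v : E3) : negXFun v 1 = v 1 := by simp [negXFun]
/-- `negXFun_apply_two` (docstring added by the landing lane; see the module docstring). [formal bookkeeping] -/
@[simp] theorem negXFun_apply_two (v : E3) : negXFun v 2 = v 2 := by simp [negXFun]
/-- `negZFun_apply_zero` (docstring added by the landing lane; see the module docstring). [formal bookkeeping] -/
@[simp] theorem negZFun_apply_zero (v : E3) : negZFun v 0 = v 0 := by simp [negZFun]
/-- `negZFun_apply_one` (docstring added by the landing lane; see the module docstring). [formal bookkeeping] -/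
@[simp] theorem negZFun_apply_one (v : E3) : negZFun v 1 = v 1 := by simp [negZFun]
/-- `negZFun_apply_two` (docstring added by the landing lane; see the module docstring). [formal bookkeeping] -/
@[simp] theorem negZFun_apply_two (v : E3) : negZFun v 2 = -v 2 := by simp [negZFun]
/-- `swapUVFun_apply_zero` (docstring added by the landing lane; see the module docstring). [formal bookkeeping] -/
@[simp] theorem swapUVFun_apply_zero (v : E3) : swapUVFun v 0 = v 0 / 2 + Real.sqrt 3 / 2 * v 1 := by simp [swapUVFun]
/-- `swapUVFun_apply_one` (docstring added by the landing lane; see the module docstring). [formal bookkeeping] -/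
@[simp] theorem swapUVFun_apply_one (v : E3) : swapUVFun v 1 = Real.sqrt 3 / 2 * v 0 - v 1 / 2 := by simp [swapUVFun]
/-- `swapUVFun_apply_two` (docstring added by the landing lane; see the module docstring). [formal bookkeeping] -/
@[simp] theorem swapUVFun_apply_two (v : E3) : swapUVFun v 2 = v 2 := by simp [swapUVFun]

/-- `sqrt3_mul_sqrt3` (docstring added by the landing lane; see the module docstring). [formal bookkeeping] (dedup gate: public twin Literature.Probability.RandomPlanarGeometry.sqrt3_mul_self in an unrelated module; kept PRIVATE) -/
private theorem sqrt3_mul_sqrt3 : Real.sqrt 3 * Real.sqrt 3 = 3 := Real.mul_self_sqrt (by norm_num)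

/-- `negXFun_involutive` (docstring added by the landing lane; see the module docstring). [formal bookkeeping] -/
theorem negXFun_involutive : Function.Involutive negXFun := fun v => by
  ext l; fin_cases l <;> simp
/-- `negZFun_involutive` (docstring added by the landing lane; see the module docstring). [formal bookkeeping] -/
theorem negZFun_involutive : Function.Involutive negZFun := fun v => by
  ext l; fin_cases l <;> simp
/-- `swapUVFun_involutive` (docstring added by the landing lane; see the module docstring). [formal bookkeeping] -/
theorem swapUVFun_involutive : Function.Involutive swapUVFun := fun v => by
  ext l; fin_cases l
  · simp; linear_combination (v.ofLp 0 / 4) * sqrt3_mul_sqrt3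
  · simp; linear_combination (v.ofLp 1 / 4) * sqrt3_mul_sqrt3
  · simp

/-- The three mirrors as linear maps. -/
def negXLinear : E3 →ₗ[ℝ] E3 where
  toFun := negXFun
  map_add' v w := by ext l; fin_cases l <;> simp; ring
  map_smul' c v := by ext l; fin_cases l <;> simp
/-- `negZLinear` (docstring added by the landing lane; see the module docstring). [formal bookkeeping] -/
def negZLinear : E3 →ₗ[ℝ] E3 where
  toFun := negZFun
  map_add' v w := by ext l; fin_cases l <;> simp; ring
  map_smul' c v := by ext l; fin_cases l <;> simp
/-- `swapUVLinear` (docstring added by the landing lane; see the module docstring). [formal bookkeeping] -/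
def swapUVLinear : E3 →ₗ[ℝ] E3 where
  toFun := swapUVFun
  map_add' v w := by ext l; fin_cases l <;> simp <;> ring
  map_smul' c v := by ext l; fin_cases l <;> simp <;> ring

/-- The three mirrors as linear isometry equivalences. -/
def negX : E3 ≃ₗᵢ[ℝ] E3 :=
  { LinearEquiv.ofInvolutive negXLinear negXFun_involutive with
    norm_map' := fun v => by
      change ‖negXFun v‖ = ‖v‖
      simp only [EuclideanSpace.norm_eq, Fin.sum_univ_three, negXFun_apply_zero, negXFun_apply_one, negXFun_apply_two, norm_neg] }
/-- `negZ` (docstring added by the landing lane; see the module docstring). [formal bookkeeping] -/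
def negZ : E3 ≃ₗᵢ[ℝ] E3 :=
  { LinearEquiv.ofInvolutive negZLinear negZFun_involutive with
    norm_map' := fun v => by
      change ‖negZFun v‖ = ‖v‖
      simp only [EuclideanSpace.norm_eq, Fin.sum_univ_three, negZFun_apply_zero, negZFun_apply_one, negZFun_apply_two, norm_neg] }
/-- `swapUV` (docstring added by the landing lane; see the module docstring). [formal bookkeeping] -/
def swapUV : E3 ≃ₗᵢ[ℝ] E3 :=
  { LinearEquiv.ofInvolutive swapUVLinear swapUVFun_involutive with
    norm_map' := fun v => by
      change ‖swapUVFun v‖ = ‖v‖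
      rw [EuclideanSpace.norm_eq, EuclideanSpace.norm_eq]
      congr 1
      simp only [Fin.sum_univ_three, swapUVFun_apply_zero, swapUVFun_apply_one, swapUVFun_apply_two, Real.norm_eq_abs, sq_abs]
      nlinarith [sqrt3_mul_sqrt3] }

/-- `negX_apply` (docstring added by the landing lane; see the module docstring). [formal bookkeeping] -/
@[simp] theorem negX_apply (v : E3) : negX v = negXFun v := rfl
/-- `negZ_apply` (docstring added by the landing lane; see the module docstring). [formal bookkeeping] -/
@[simp] theorem negZ_apply (v : E3) : negZ v = negZFun v := rfl
/-- `swapUV_apply` (docstring added by the landing lane; see the module docstring). [formal bookkeeping] -/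
@[simp] theorem swapUV_apply (v : E3) : swapUV v = swapUVFun v := rfl

/-- ★ The only vector fixed by the three mirrors is `0`. -/
theorem eq_zero_of_fixed {F : E3} (h1 : negX F = F) (h2 : negZ F = F) (h3 : swapUV F = F) : F = 0 := by
  have e0 : F 0 = 0 := by
    have := congrArg (fun v : E3 => v 0) h1
    simp at this; linarith
  have e2 : F 2 = 0 := by
    have := congrArg (fun v : E3 => v 2) h2
    simp at this; linarith
  have e1 : F 1 = 0 := by
    have := congrArg (fun v : E3 => v 1) h3
    simp [e0] at this; linarith
  ext l; fin_cases l
  · exact e0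
  · exact e1
  · exact e2

/-! ### The three mirrors map hcp onto itself -/

variable (a h : ℝ)

/-- `negZ_barlowPos` (docstring added by the landing lane; see the module docstring). [formal bookkeeping] -/
theorem negZ_barlowPos (k i j : ℤ) :
    negZ (barlowPos a h alternatingHagg k i j) = barlowPos a h alternatingHagg (-k) i j := by
  have hl : haggLabel alternatingHagg (-k) = haggLabel alternatingHagg k := by
    rw [haggLabel_alternating, haggLabel_alternating]
    simp only [even_neg]
  ext l; fin_cases l <;>
    simp [barlowPos, triangularVec₁, triangularVec₂, barlowOffset, layerNormal, hl]

/-- `negX_barlowPos` (docstring added by the landing lane; see the module docstring). [formal bookkeeping] -/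
theorem negX_barlowPos (k i j : ℤ) :
    negX (barlowPos a h alternatingHagg k i j) = barlowPos a h alternatingHagg k (-i - j - haggLabel alternatingHagg k) j := by
  ext l; fin_cases l <;> simp [barlowPos, triangularVec₁, triangularVec₂, barlowOffset, layerNormal]; ring

/-- `swapUV_barlowPos` (docstring added by the landing lane; see the module docstring). [formal bookkeeping] -/
theorem swapUV_barlowPos (k i j : ℤ) :
    swapUV (barlowPos a h alternatingHagg k i j) = barlowPos a h alternatingHagg k j i := by
  ext l; fin_cases l
  · simp [barlowPos, triangularVec₁, triangularVec₂, barlowOffset, layerNormal]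
    linear_combination ((j : ℝ) * a / 4 + (haggLabel alternatingHagg k : ℝ) * a / 12) * sqrt3_mul_sqrt3
  · simp [barlowPos, triangularVec₁, triangularVec₂, barlowOffset, layerNormal]
    nlinarith [sqrt3_mul_sqrt3]
  · simp [barlowPos, triangularVec₁, triangularVec₂, barlowOffset, layerNormal]

/-- An involutive map sending the stacking into itself maps it ONTO itself. -/
theorem mem_iff_of_involutive_maps {S : Set E3} {f : E3 → E3} (hf : Function.Involutive f) (hmaps : ∀ q ∈ S, f q ∈ S) (q : E3) :
    q ∈ S ↔ f q ∈ S :=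
  ⟨hmaps q, fun hq => by rw [← hf q]; exact hmaps _ hq⟩

/-- `hcp_negZ_iff` (docstring added by the landing lane; see the module docstring). [formal bookkeeping] -/
theorem hcp_negZ_iff (q : E3) : q ∈ hcpStacking a h ↔ negZ q ∈ hcpStacking a h := by
  refine mem_iff_of_involutive_maps (f := fun v => negZ v) (fun v => negZFun_involutive v) (fun q hq => ?_) q
  obtain ⟨k, i, j, rfl⟩ := hq
  exact ⟨-k, i, j, negZ_barlowPos a h k i j⟩

/-- `hcp_negX_iff` (docstring added by the landing lane; see the module docstring). [formal bookkeeping] -/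
theorem hcp_negX_iff (q : E3) : q ∈ hcpStacking a h ↔ negX q ∈ hcpStacking a h := by
  refine mem_iff_of_involutive_maps (f := fun v => negX v) (fun v => negXFun_involutive v) (fun q hq => ?_) q
  obtain ⟨k, i, j, rfl⟩ := hq
  exact ⟨k, -i - j - haggLabel alternatingHagg k, j, negX_barlowPos a h k i j⟩

/-- `hcp_swapUV_iff` (docstring added by the landing lane; see the module docstring). [formal bookkeeping] -/
theorem hcp_swapUV_iff (q : E3) : q ∈ hcpStacking a h ↔ swapUV q ∈ hcpStacking a h := by
  refine mem_iff_of_involutive_maps (f := fun v => swapUV v) (fun v => swapUVFun_involutive v) (fun q hq => ?_) q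
  obtain ⟨k, i, j, rfl⟩ := hq
  exact ⟨k, j, i, swapUV_barlowPos a h k i j⟩

variable {a h}

/-- ★ The site force of hcp at the origin vanishes (three mirrors). -/
theorem siteForce_hcp_zero (ha : a ≠ 0) (hh : h ≠ 0) : siteForce (hcpPeriodicConfiguration ha hh) 0 = 0 := by
  have hpts := hcpPeriodicConfiguration_points ha hh
  refine eq_zero_of_fixed ?_ ?_ ?_
  · exact (siteForce_zero_eq_map _ negX fun q => by rw [hpts]; exact hcp_negX_iff a h q).symm
  · exact (siteForce_zero_eq_map _ negZ fun q => by rw [hpts]; exact hcp_negZ_iff a h q).symm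
  · exact (siteForce_zero_eq_map _ swapUV fun q => by rw [hpts]; exact hcp_swapUV_iff a h q).symm

/-- ★★ **THE hcp REFERENCE IS FORCE-FREE**, at every cell `(a, h)` (no stress-free tuning needed: site symmetry `D₃ₕ`). -/
theorem isForceFree_hcp (ha : a ≠ 0) (hh : h ≠ 0) : IsForceFree (hcpPeriodicConfiguration ha hh) := by
  intro y hy
  have hy' : y ∈ (hcpPeriodicConfiguration ha hh).points := PeriodicConfiguration.mem_points_of_mem_motif _ hy
  obtain ⟨B, hB⟩ := hcpPeriodicConfiguration_homogeneous a h ha hh hy'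
  change siteForce (hcpPeriodicConfiguration ha hh) y = 0
  rw [siteForce_eq_map_of_homogeneous _ B hB, siteForce_hcp_zero ha hh, LinearIsometryEquiv.map_zero]

/-- The site force of hcp vanishes at EVERY point of the stacking (not only at the motif representatives). -/
theorem siteForce_hcp_eq_zero (ha : a ≠ 0) (hh : h ≠ 0) {y : E3} (hy : y ∈ (hcpPeriodicConfiguration ha hh).points) :
    siteForce (hcpPeriodicConfiguration ha hh) y = 0 := by
  obtain ⟨B, hB⟩ := hcpPeriodicConfiguration_homogeneous a h ha hh hy
  rw [siteForce_eq_map_of_homogeneous _ B hB, siteForce_hcp_zero ha hh, LinearIsometryEquiv.map_zero]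

/-- The hcp reference is `s`-SEPARATED for every `s ≤ min a h` (tree: `le_dist_of_mem_barlowStacking`). -/
theorem isSeparatedRef_hcp (ha : a ≠ 0) (hh : h ≠ 0) (ha₀ : 0 ≤ a) (hh₀ : 0 ≤ h) {s : ℝ} (hs : s ≤ min a h) :
    IsSeparatedRef s (hcpPeriodicConfiguration ha hh) := by
  intro y hy z hz hyz
  rw [hcpPeriodicConfiguration_points] at hy hz
  exact hs.trans (le_dist_of_mem_barlowStacking a h alternatingHagg ha₀ hh₀ hy hz hyz)

/-- At the record separation dial `s = 3/5`: every hcp cell with `a, h ≥ 3/5` (in particular the census cell `(a*, h*) ≈ (0.9713, 0.7929)`) is admissible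
for the `IsSeparatedRef` slot of `LocalSeamTransferBoundS`. -/
theorem record_isSeparatedRef_hcp (ha : a ≠ 0) (hh : h ≠ 0) (ha₀ : 3 / 5 ≤ a) (hh₀ : 3 / 5 ≤ h) :
    IsSeparatedRef (3 / 5) (hcpPeriodicConfiguration ha hh) :=
  isSeparatedRef_hcp ha hh (by linarith) (by linarith) (le_min ha₀ hh₀)

/-- The hcp reference is BARLOW-LABELLED at every strain `lam ≥ 0` within every `ℓ ≥ 0`, at every cell of the Barlow window (the chart is the stacking
itself with the identity labelling; tree `isBarlowImage_barlowStacking`, `isHaggSeq_alternating`). -/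
theorem isLabelledRef_hcp (ha : a ≠ 0) (hh : h ≠ 0) (haw : 9 / 10 ≤ a ∧ a ≤ 11 / 10)
    (hhw : 0 < h ∧ 27 / 50 * a ^ 2 ≤ h ^ 2 ∧ h ^ 2 ≤ 121 / 150 * a ^ 2) {lam ℓ : ℝ} (hlam : 0 ≤ lam) (hℓ : 0 ≤ ℓ) :
    IsLabelledRef lam ℓ (hcpPeriodicConfiguration ha hh) := by
  intro y hy
  have hy' := PeriodicConfiguration.mem_points_of_mem_motif _ hy
  have hpts := hcpPeriodicConfiguration_points ha hh
  have hS : IsBarlowImage (hcpStacking a h) := isBarlowImage_barlowStacking haw hhw isHaggSeq_alternating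
  refine ⟨hcpStacking a h, hS, id, y, by rw [← hpts]; exact hy', rfl, ?_, ?_, ?_⟩
  · intro x hx _
    rw [hpts]; exact hx
  · intro q hq hqd
    exact ⟨q, by rw [← hpts]; exact hq, by linarith, rfl⟩
  · intro x _ x' _ _ _
    simp only [id, sub_self, norm_zero]
    positivity

/-- At the record dials `(lam, ℓ) = (1/3, 3)`. -/
theorem record_isLabelledRef_hcp (ha : a ≠ 0) (hh : h ≠ 0) (haw : 9 / 10 ≤ a ∧ a ≤ 11 / 10)
    (hhw : 0 < h ∧ 27 / 50 * a ^ 2 ≤ h ^ 2 ∧ h ^ 2 ≤ 121 / 150 * a ^ 2) : IsLabelledRef (1 / 3) 3 (hcpPeriodicConfiguration ha hh) :=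
  isLabelledRef_hcp ha hh haw hhw (by norm_num) (by norm_num)

/-- ★★ **hcp REFERENCE ADMISSIBILITY (the symmetric three of the five slots)** at the record dials, for EVERY cell of the Barlow window:
`IsSeparatedRef (3/5) ∧ IsLabelledRef (1/3) 3 ∧ IsForceFree` — leaving exactly `IsSiteStressFree` (two-atom lemma P-N + census box, g63 (c)) and
`HarmStableModRot` (STAB-k for hcp) as the priced slots of the hcp-cell chart (memo §1.7). -/
theorem hcp_admissible_symmetric (ha : a ≠ 0) (hh : h ≠ 0) (haw : 9 / 10 ≤ a ∧ a ≤ 11 / 10)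
    (hhw : 0 < h ∧ 27 / 50 * a ^ 2 ≤ h ^ 2 ∧ h ^ 2 ≤ 121 / 150 * a ^ 2) :
    IsSeparatedRef (3 / 5) (hcpPeriodicConfiguration ha hh) ∧ IsLabelledRef (1 / 3) 3 (hcpPeriodicConfiguration ha hh) ∧
      IsForceFree (hcpPeriodicConfiguration ha hh) := by
  have hfl := IsBarlowImage.window_floor haw hhw
  exact ⟨record_isSeparatedRef_hcp ha hh (by linarith [hfl.1]) (by linarith [hfl.2]), record_isLabelledRef_hcp ha hh haw hhw, isForceFree_hcp ha hh⟩

end HcpForceFree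

end Summit.AtomisticToContinuum.Crystallization.Theorems.ChargedEnergyGapChartDial
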